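import Literature.MathematicalPhysics.QuantumFieldTheory.ChatterjeeFreeEnergyJointLimit
import Summits.QuantumFields.YangMills.Theorems.EntropyBudgetEquipartitionFreeEnergyRateMaxwellRate

/-!
# Chatterjee's Theorem 2.1 for `U(N)` WITH A POWER RATE — part 1: the two-sided bounds, quantified

Helper for the crux `FreeEnergyRate` (stmt-QuantumFields-22402) of route `EntropyBudgetEquipartition`.
The tree proves Chatterjee's joint limit `T(B_n, β) → A = (d−1) log c_H + N² L_d` (arXiv:1602.01222 Thm. 2.1,
`ChatterjeeJointLimit.tendsto_T`) by Lemmas 17.4 / 17.7 whose every error term is an explicit negative power of `β`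
(times `log β`) EXCEPT the main-term input `G(m) → A`, which rests on the rate-free Theorem 15.2. With the rate
`|log Z_M(B_m)/m^d − L_d| ≤ C_d (log m + 1)/m` (`FreeEnergyRate.abs_fM_sub_lim_le`, this seat) the main term gets
`|G(m) − A| ≤ c_G/√m` (`abs_G_sub_lim_le`), and the printed §17 argument, run pointwise with its thresholds made
explicit, gives:

* `T_le_lim_add` (Lemma 17.4 quantified): for `β ≥ 2`, `V(β) ≤ 1/64`, `u = β^{a/2} ≥ 2` and every `n ≥ u`,
  `T(B_n, β) ≤ A + c_G√2/√u + 2 log 2/u + √(67²·64·N²d⁴·max(V(β),0)³) + 2K₂ log β/u`;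
* `lim_sub_le_T` (Lemma 17.7 quantified, regimes C and D): under the tree's thresholds in `β` and for every
  `n ≥ β`, `T(B_n, β) ≥ A − (c_G/√β + e₀(β) + err_LB(β) + K₃ β^{b−c} log β + J_D(β))`.

Part 2 (`…UnitaryRate`) absorbs every error into `β^{−b/2}` and transfers to the torus free energy density.
HONEST LABEL: `U(N)` is not a compact SIMPLE group, so this is the K1 mechanism with a power rate for the unitary
models the tree can chart (Cayley chart of `U(N)`), filed `--supports`; it does not close the crux (abstract compact
simple `G`), and nothing here bears on the Clay mass gap (the route serves the RECORD-label rung R2ξ-G `XiPow`).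

References: S. Chatterjee, *The leading term of the Yang–Mills free energy*, J. Funct. Anal. 271 (2016),
arXiv:1602.01222, §17 (Lemmas 17.1–17.7), Thm. 2.1.
-/

noncomputable section

namespace Summit.QuantumFields.YangMills.Theorems.FreeEnergyRate

open Filter Topology
open scoped NNReal
open Literature.MathematicalPhysics.QuantumFieldTheory
open Literature.MathematicalPhysics.QuantumFieldTheory.UnitaryCayley
open Literature.MathematicalPhysics.QuantumFieldTheory.WilsonWeakCoupling
open Literature.MathematicalPhysics.QuantumFieldTheory.LatticeMaxwell
open Literature.MathematicalPhysics.QuantumFieldTheory.ChatterjeeAssembly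
open Literature.MathematicalPhysics.QuantumFieldTheory.ChatterjeeFreeEnergy
open Literature.MathematicalPhysics.QuantumFieldTheory.ChatterjeeJointLimit

variable {d N : ℕ}

/-! ### §1. Rate of the main term `G(m)` -/

/-- **Lemma 17.1 with a rate**: `|coef m − (d−1)| ≤ (d+1)/m` for `m ≥ 1` (let `n → ∞` in the tree's
`abs_coef_sub_le`). [cite: arXiv160201222, Lemma 17.1] -/
theorem abs_coef_sub_lim_le (hd : 1 ≤ d) {m : ℕ} (hm : 1 ≤ m) :
    |coef d m - ((d : ℝ) - 1)| ≤ ((d : ℝ) + 1) / m := by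
  have ht : Tendsto (fun n : ℕ => |coef d n - coef d m|) atTop (𝓝 (|((d : ℝ) - 1) - coef d m|)) :=
    ((tendsto_coef hd).sub_const _).abs
  have hev : ∀ᶠ n : ℕ in atTop, |coef d n - coef d m| ≤ ((d : ℝ) + 1) / m :=
    eventually_atTop.2 ⟨m, fun n hn => abs_coef_sub_le hd hm hn⟩
  have := le_of_tendsto ht hev
  rwa [abs_sub_comm] at this

/-- `log x + 1 ≤ 3√x` for `x ≥ 1`. [folklore] -/
theorem log_add_one_le_three_sqrt {x : ℝ} (hx : 1 ≤ x) : Real.log x + 1 ≤ 3 * Real.sqrt x := by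
  have h1 : Real.log x ≤ x ^ (1 / 2 : ℝ) / (1 / 2) := Real.log_le_rpow_div (by linarith) (by norm_num)
  rw [← Real.sqrt_eq_rpow] at h1
  have h2 : 1 ≤ Real.sqrt x := Real.one_le_sqrt.2 hx
  linarith

/-- **Rate of the main term**: if `log Z_M(B_n)/n^d → L` then for every `m ≥ 2`
`|G(m) − A| ≤ c_G/√m`, `A = (d−1) log c_H + N² L`, `c_G = (d+1)|log c_H| + 3N²·4Cke(d)(9d+13)`
(Lemma 17.1 with rate + Theorem 15.2 with rate). [cite: arXiv160201222, §17 (proof of Thm. 2.1)] -/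
theorem abs_G_sub_lim_le (hd : 1 ≤ d) {L : ℝ}
    (hL : Tendsto (fun n : ℕ => logZM d n / (n : ℝ) ^ d) atTop (𝓝 L)) {A cG : ℝ}
    (hA : A = ((d : ℝ) - 1) * Real.log ((haarChartConst N : ℝ≥0) : ℝ) + (N : ℝ) ^ 2 * L)
    (hcG : cG = ((d : ℝ) + 1) * |Real.log ((haarChartConst N : ℝ≥0) : ℝ)| +
      3 * (N : ℝ) ^ 2 * (4 * Cke d * (9 * d + 13)))
    {m : ℕ} (hm : 2 ≤ m) :
    |G d N m - A| ≤ cG / Real.sqrt m := by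
  set lc : ℝ := Real.log ((haarChartConst N : ℝ≥0) : ℝ) with hlc
  set Cr : ℝ := 4 * Cke d * (9 * d + 13) with hCr
  have hCr0 : 0 ≤ Cr := maxwellRateConst_nonneg d
  have hm1 : 1 ≤ m := by omega
  have hm0 : (0 : ℝ) < m := by exact_mod_cast (show 0 < m by omega)
  have hmr1 : (1 : ℝ) ≤ m := by exact_mod_cast hm1
  have hsq0 : 0 < Real.sqrt m := Real.sqrt_pos.2 hm0
  have hsq1 : 1 ≤ Real.sqrt m := Real.one_le_sqrt.2 hmr1
  have hsqm : Real.sqrt m * Real.sqrt m = m := Real.mul_self_sqrt hm0.le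
  have hsq_le : Real.sqrt m ≤ m := by
    calc Real.sqrt m = Real.sqrt m * 1 := (mul_one _).symm
      _ ≤ Real.sqrt m * Real.sqrt m := mul_le_mul_of_nonneg_left hsq1 hsq0.le
      _ = m := hsqm
  have h1 := abs_coef_sub_lim_le hd hm1
  have h2 := abs_fM_sub_lim_le (d := d) hd hL hm
  have h3 := log_add_one_le_three_sqrt hmr1
  have h4 : (Real.log m + 1) / m ≤ 3 / Real.sqrt m := by
    rw [div_le_div_iff₀ hm0 hsq0]
    calc (Real.log m + 1) * Real.sqrt m ≤ 3 * Real.sqrt m * Real.sqrt m :=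
          mul_le_mul_of_nonneg_right h3 hsq0.le
      _ = 3 * m := by rw [mul_assoc, hsqm]
  have hG : G d N m - A = (coef d m - ((d : ℝ) - 1)) * lc + (N : ℝ) ^ 2 * (fM d m - L) := by
    rw [hA]; simp only [G, fM, hlc]; ring
  rw [hG]
  have hN2 : (0 : ℝ) ≤ (N : ℝ) ^ 2 := by positivity
  calc |(coef d m - ((d : ℝ) - 1)) * lc + (N : ℝ) ^ 2 * (fM d m - L)|
      ≤ |(coef d m - ((d : ℝ) - 1)) * lc| + |(N : ℝ) ^ 2 * (fM d m - L)| := abs_add_le _ _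
    _ = |coef d m - ((d : ℝ) - 1)| * |lc| + (N : ℝ) ^ 2 * |fM d m - L| := by
        rw [abs_mul, abs_mul, abs_of_nonneg hN2]
    _ ≤ ((d : ℝ) + 1) / m * |lc| + (N : ℝ) ^ 2 * (Cr * (Real.log m + 1) / m) :=
        add_le_add (mul_le_mul_of_nonneg_right h1 (abs_nonneg _)) (mul_le_mul_of_nonneg_left h2 hN2)
    _ ≤ ((d : ℝ) + 1) / Real.sqrt m * |lc| + (N : ℝ) ^ 2 * (Cr * (3 / Real.sqrt m)) := by
        refine add_le_add (mul_le_mul_of_nonneg_right ?_ (abs_nonneg _)) (mul_le_mul_of_nonneg_left ?_ hN2)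
        · exact div_le_div_of_nonneg_left (by positivity) hsq0 hsq_le
        · rw [mul_div_assoc]; exact mul_le_mul_of_nonneg_left h4 hCr0
    _ = cG / Real.sqrt m := by rw [hcG]; field_simp

/-! ### §2. Lemma 17.4 quantified: the upper bound -/

/-- **Lemma 17.4 with explicit errors.** For `β ≥ 2` with `V(β) ≤ 1/64` and `u = β^{a/2} ≥ 2` (`a = aU d`), and
every cube side `n ≥ u`: `T(B_n, β) ≤ A + c_G√2/√u + 2 log 2/u + √(67²·64·N²d⁴·max(V(β),0)³) + K₂·(2 log β/u)`.
Proof exactly as printed/as in the tree's `eventually_T_le`: `n ≤ β^a` by Lemma 17.2 directly, else compare with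
`m = min(⌊β^a⌋, ⌊n/u⌋)` by Lemma 17.3. [cite: arXiv160201222, Lemma 17.4] -/
theorem T_le_lim_add (hd : 2 ≤ d) {L : ℝ}
    (hL : Tendsto (fun n : ℕ => logZM d n / (n : ℝ) ^ d) atTop (𝓝 L)) {A cG : ℝ}
    (hA : A = ((d : ℝ) - 1) * Real.log ((haarChartConst N : ℝ≥0) : ℝ) + (N : ℝ) ^ 2 * L)
    (hcG : cG = ((d : ℝ) + 1) * |Real.log ((haarChartConst N : ℝ≥0) : ℝ)| +
      3 * (N : ℝ) ^ 2 * (4 * Cke d * (9 * d + 13)))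
    {β : ℝ} (hβ2 : 2 ≤ β) (hV : Vf d (C71 d N) β ≤ 1 / 64) (hu2 : 2 ≤ β ^ (aU d / 2))
    {n : ℕ} (hn : β ^ (aU d / 2) ≤ n) :
    T d N n β ≤ A + (cG * Real.sqrt 2 / Real.sqrt (β ^ (aU d / 2)) + 2 * Real.log 2 / β ^ (aU d / 2) +
      Real.sqrt (67 ^ 2 * 64 * (N : ℝ) ^ 2 * (d : ℝ) ^ 4 * (max (Vf d (C71 d N) β) 0) ^ 3) +
      K₂ d N * (2 * Real.log β / β ^ (aU d / 2))) := by
  have hd1 : 1 ≤ d := by omega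
  set C := C71 d N with hC
  have hC0 : 0 < C := (C71_spec d N).1
  set a := aU d with ha
  have hβ1 : 1 ≤ β := by linarith
  have hβ0 : 0 < β := by linarith
  have hL0 : 0 ≤ Real.log β := Real.log_nonneg hβ1
  have hcG0 : 0 ≤ cG := by rw [hcG]; have := maxwellRateConst_nonneg d; positivity
  set E3 : ℝ := Real.sqrt (67 ^ 2 * 64 * (N : ℝ) ^ 2 * (d : ℝ) ^ 4 * (max (Vf d C β) 0) ^ 3) with hE3
  have hE3nn : 0 ≤ E3 := Real.sqrt_nonneg _
  generalize hu : β ^ (a / 2) = u at hu2 hn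
  have hu0 : 0 < u := by linarith
  have hu2sq : u ^ 2 = β ^ a := by
    rw [← hu, ← Real.rpow_natCast, ← Real.rpow_mul hβ0.le]; congr 1; push_cast; ring
  have hK₂0 : 0 ≤ K₂ d N * (2 * Real.log β / u) := by have := K₂_nonneg (d := d) (N := N); positivity
  -- the main-term rate at scales `m ≥ u/2`
  have Grate : ∀ m : ℕ, 2 ≤ m → u / 2 ≤ (m : ℝ) → G d N m ≤ A + cG * Real.sqrt 2 / Real.sqrt u := by
    intro m hm2 hmu
    have h := abs_G_sub_lim_le (N := N) hd1 hL hA hcG hm2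
    have hm0 : (0 : ℝ) < m := by exact_mod_cast (show 0 < m by omega)
    have hs : Real.sqrt u ≤ Real.sqrt 2 * Real.sqrt m := by
      rw [← Real.sqrt_mul (by norm_num : (0 : ℝ) ≤ 2)]
      exact Real.sqrt_le_sqrt (by linarith)
    have hle : cG / Real.sqrt m ≤ cG * Real.sqrt 2 / Real.sqrt u := by
      rw [div_le_div_iff₀ (Real.sqrt_pos.2 hm0) (Real.sqrt_pos.2 hu0)]
      calc cG * Real.sqrt u ≤ cG * (Real.sqrt 2 * Real.sqrt m) := mul_le_mul_of_nonneg_left hs hcG0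
        _ = cG * Real.sqrt 2 * Real.sqrt m := by ring
    linarith [(abs_le.1 h).2]
  -- `log 2/m^d ≤ 2 log 2/u` for `m ≥ u/2`, `m ≥ 1`
  have logle : ∀ m : ℕ, 1 ≤ m → u / 2 ≤ (m : ℝ) → Real.log 2 / (m : ℝ) ^ d ≤ 2 * Real.log 2 / u := by
    intro m hm1 hmu
    have hm0 : (0 : ℝ) < m := by exact_mod_cast hm1
    have hmd : (m : ℝ) ≤ (m : ℝ) ^ d := le_self_pow₀ (by exact_mod_cast hm1) (by omega)
    have hl2 : 0 ≤ Real.log 2 := Real.log_nonneg one_le_two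
    calc Real.log 2 / (m : ℝ) ^ d ≤ Real.log 2 / m := div_le_div_of_nonneg_left hl2 hm0 hmd
      _ ≤ Real.log 2 / (u / 2) := div_le_div_of_nonneg_left hl2 (by positivity) hmu
      _ = 2 * Real.log 2 / u := by field_simp
  -- Case A (Lemma 17.2 at a scale `m ≤ β^a`)
  have caseA : ∀ m : ℕ, 2 ≤ m → u / 2 ≤ (m : ℝ) → (m : ℝ) ≤ β ^ a →
      T d N m β ≤ A + cG * Real.sqrt 2 / Real.sqrt u + 2 * Real.log 2 / u + E3 := by
    intro m hm2 hmu hma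
    have hm1 : 1 ≤ m := by omega
    have hρ := rho0_le_eighth (d := d) hC0 hβ1 hma hV
    have h := T_le_G_add (d := d) (N := N) hβ2 hm1 hρ
    have hE0 : 0 ≤ 67 * β * N * (2 * rho0 C d m β) ^ 3 * ((d : ℝ) * d) := by
      have := rho0_nonneg C d m β; positivity
    have hEsq := errU_sq_le (d := d) (N := N) hC0 hβ1 hma
    have hX : 67 * β * N * (2 * rho0 C d m β) ^ 3 * ((d : ℝ) * d) ≤ E3 :=
      (Real.le_sqrt hE0 (by positivity)).2 hEsq
    have hG := Grate m hm2 hmu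
    have hl := logle m hm1 hmu
    linarith
  by_cases hcase : (n : ℝ) ≤ β ^ a
  · have hn2r : (2 : ℝ) ≤ n := hu2.trans hn
    have hn2 : 2 ≤ n := by exact_mod_cast hn2r
    have h := caseA n hn2 (by linarith) hcase
    linarith
  · push Not at hcase
    have hβa0 : 0 ≤ β ^ a := Real.rpow_nonneg hβ0.le a
    have hn0 : (0 : ℝ) < n := by linarith
    obtain ⟨m, f1, f2, f3⟩ : ∃ m : ℕ, (m : ℝ) ≤ β ^ a ∧ (m : ℝ) ≤ n / u ∧ u - 1 < m := by
      refine ⟨min ⌊β ^ a⌋₊ ⌊(n : ℝ) / u⌋₊, ?_, ?_, ?_⟩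
      · exact le_trans (by exact_mod_cast min_le_left _ _) (Nat.floor_le hβa0)
      · exact le_trans (by exact_mod_cast min_le_right _ _) (Nat.floor_le (by positivity))
      · have h1 : β ^ a - 1 < ⌊β ^ a⌋₊ := by linarith [Nat.lt_floor_add_one (β ^ a)]
        have h2 : (n : ℝ) / u - 1 < ⌊(n : ℝ) / u⌋₊ := by linarith [Nat.lt_floor_add_one ((n : ℝ) / u)]
        have hua : u ≤ β ^ a := by rw [← hu2sq]; nlinarith
        have hnu : u < n / u := by rw [lt_div_iff₀ hu0]; nlinarith
        rcases Nat.le_total ⌊β ^ a⌋₊ ⌊(n : ℝ) / u⌋₊ with hle | hle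
        · rw [min_eq_left hle]; linarith
        · rw [min_eq_right hle]; linarith
    have hm2 : 2 ≤ m := by
      have : (1 : ℝ) < m := by linarith
      have : 1 < m := by exact_mod_cast this
      omega
    have hm1 : 1 ≤ m := by omega
    have hm0 : (0 : ℝ) < m := by exact_mod_cast hm1
    have hmu : u / 2 ≤ (m : ℝ) := by linarith
    have hmn : m + 1 ≤ n := by
      have : (m : ℝ) < n := by
        calc (m : ℝ) ≤ n / u := f2
          _ < n := by rw [div_lt_iff₀ hu0]; nlinarith
      exact_mod_cast this
    -- `w = 1/(u-1)`
    have hw1 : (m : ℝ) / n ≤ 1 / (u - 1) := by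
      rw [div_le_div_iff₀ hn0 (by linarith)]
      rw [le_div_iff₀ hu0] at f2
      nlinarith
    have hw3 : 1 / (m : ℝ) ≤ 1 / (u - 1) :=
      div_le_div_of_nonneg_left zero_le_one (by linarith) (by linarith)
    have hcmp := T_le_T_add (d := d) (N := N) hd1 hβ2 hm1 hmn hw1 hw3
    have hTm := caseA m hm2 hmu f1
    have hjunk' : K₂ d N * (1 / (u - 1) * Real.log β) ≤ K₂ d N * (2 * Real.log β / u) := by
      have hw4 : 1 / (u - 1) ≤ 2 / u := by
        rw [div_le_div_iff₀ (by linarith) hu0]; linarith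
      have : 1 / (u - 1) * Real.log β ≤ 2 * Real.log β / u := by
        calc 1 / (u - 1) * Real.log β ≤ (2 / u) * Real.log β := mul_le_mul_of_nonneg_right hw4 hL0
          _ = 2 * Real.log β / u := by ring
      exact mul_le_mul_of_nonneg_left this K₂_nonneg
    linarith

/-! ### §3. Lemma 17.7 quantified: the lower bound (regimes C and D) -/

/-- `c = cL d < 1`. [folklore] -/
theorem cL_lt_one : cL d < 1 := by
  unfold cL
  rw [div_lt_one (by positivity)]
  have : (0 : ℝ) ≤ d := Nat.cast_nonneg d
  linarith

/-- `J_D(β) ≥ 0` for `β ≥ 1`. [folklore] -/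
theorem JD_nonneg {β : ℝ} (hβ : 1 ≤ β) : 0 ≤ JD d N β := by
  have hβ0 : 0 < β := by linarith
  have hL0 : 0 ≤ Real.log β := Real.log_nonneg hβ
  have hK := Kc_nonneg (d := d) (N := N)
  have hb : 0 ≤ β ^ bL d := Real.rpow_nonneg hβ0.le _
  unfold JD
  positivity

/-- **Lemma 17.7 with explicit errors (cube sides `n ≥ β`).** Under the tree's thresholds in `β`
(`β ≥ 2`, `β^{-2/5} ≤ 1/2`, `N ≤ β^{1/10}`, `R_b(β)/β^{1/10} ≤ 1/N`, `β^b ≥ 4`, `β^{1-b} ≥ 4`) and for every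
`n ≥ β`: `T(B_n, β) ≥ A − (c_G/√β + e₀(β) + err_LB(β) + K₃ β^b/β^c log β + J_D(β))`, by the tree's regimes
`lowC` (`β^c < n ≤ β³`) and `lowD` (`n > β³`) fed with `A₁ = A − c_G/√β ≤ G(n')` for all `n' ≥ β`
(`abs_G_sub_lim_le`). [cite: arXiv160201222, Lemma 17.7] -/
theorem lim_sub_le_T (hd : 2 ≤ d) (hN : 1 ≤ N) {L : ℝ}
    (hL : Tendsto (fun n : ℕ => logZM d n / (n : ℝ) ^ d) atTop (𝓝 L)) {A cG : ℝ}
    (hA : A = ((d : ℝ) - 1) * Real.log ((haarChartConst N : ℝ≥0) : ℝ) + (N : ℝ) ^ 2 * L)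
    (hcG : cG = ((d : ℝ) + 1) * |Real.log ((haarChartConst N : ℝ≥0) : ℝ)| +
      3 * (N : ℝ) ^ 2 * (4 * Cke d * (9 * d + 13)))
    {β : ℝ} (hβ2 : 2 ≤ β) (hr2 : β ^ (-(2 / 5 : ℝ)) ≤ 1 / 2) (hN10 : (N : ℝ) ≤ β ^ (1 / 10 : ℝ))
    (hRb : Rbfun d (bL d) β / β ^ (1 / 10 : ℝ) ≤ 1 / N) (hb4 : 4 ≤ β ^ bL d) (h4 : 4 ≤ β ^ (1 - bL d))
    {n : ℕ} (hn : β ≤ n) :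
    A - (cG / Real.sqrt β + e0 d N β + errLB d N β + K₃ d N * (β ^ bL d / β ^ cL d * Real.log β) +
      JD d N β) ≤ T d N n β := by
  have hd1 : 1 ≤ d := by omega
  have hβ1 : 1 ≤ β := by linarith
  have hβ0 : 0 < β := by linarith
  have hL0 : 0 ≤ Real.log β := Real.log_nonneg hβ1
  have hcG0 : 0 ≤ cG := by rw [hcG]; have := maxwellRateConst_nonneg d; positivity
  -- `A₁ = A - c_G/√β ≤ G(n')` for every `n' ≥ β`
  have hGge : ∀ n' : ℕ, β ≤ n' → A - cG / Real.sqrt β ≤ G d N n' := by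
    intro n' hn'
    have hn'2 : 2 ≤ n' := by exact_mod_cast (show (2 : ℝ) ≤ n' from hβ2.trans hn')
    have h := abs_G_sub_lim_le (N := N) hd1 hL hA hcG hn'2
    have hle : cG / Real.sqrt n' ≤ cG / Real.sqrt β :=
      div_le_div_of_nonneg_left hcG0 (Real.sqrt_pos.2 hβ0) (Real.sqrt_le_sqrt hn')
    linarith [(abs_le.1 h).1]
  have hK3 : 0 ≤ K₃ d N * (β ^ bL d / β ^ cL d * Real.log β) := by
    have := K₃_nonneg (d := d) (N := N)
    have : 0 ≤ β ^ bL d / β ^ cL d := div_nonneg (Real.rpow_nonneg hβ0.le _) (Real.rpow_nonneg hβ0.le _)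
    positivity
  have hJD := JD_nonneg (d := d) (N := N) hβ1
  by_cases hC : (n : ℝ) ≤ β ^ 3
  · have hnc : β ^ cL d < n := by
      have : β ^ cL d < β := by
        calc β ^ cL d < β ^ (1 : ℝ) := Real.rpow_lt_rpow_of_exponent_lt (by linarith) cL_lt_one
          _ = β := Real.rpow_one β
      linarith
    have h := lowC (d := d) hN hd1 hβ2 hr2 hN10 hRb hb4 (A₁ := A - cG / Real.sqrt β) hnc hC
      (fun n' hnn' => hGge n' (hn.trans (by exact_mod_cast hnn')))
    linarith
  · push Not at hC
    have h := lowD (d := d) hN hd1 hβ2 hr2 hN10 hRb hb4 h4 (A₁ := A - cG / Real.sqrt β) hC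
      (fun n' hβn' => hGge n' hβn')
    linarith

end Summit.QuantumFields.YangMills.Theorems.FreeEnergyRate

end
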